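import Summits.Ventures.YMGap.Thresholds.TorusStateResponse
import Summits.Ventures.YMGap.Thresholds.LinearResponseBound
import Summits.Ventures.YMGap.Thresholds.StarInfiniteVolume
import Summits.Ventures.YMGap.Thresholds.StarFrontLemmaG
import Summits.Ventures.YMGap.Thresholds.StarRows
import HarnessLib

/-!
# Venture YMGap — UNIFORM BOUND ON THE COUPLING DERIVATIVE OF THE TORUS STATES and C-LIP AT THE STAR WINDOW:
# the `SU(2)`, `d = 4` strong-coupling state is Lipschitz in the coupling for every `0 ≤ β_W ≤ 9/25`

HONEST FRAMING: venture file of the cell `pub-ymgap` (QuantumFields programme), seat ds-1.  Strong-coupling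
LATTICE statements for `SU(2)` lattice Yang–Mills on `ℤ^4` with the Wilson action inside the one-sided
vertex-STAR Dobrushin–Shlosman window `0 ≤ β_W ≤ 9/25` (tree bare coupling `β_W/2`); Lipschitz statements in the
coupling (not `C¹`, not analyticity — `C¹` is the sibling file `CouplingDerivative`); nothing about the continuum,
confinement at weak coupling, or the Clay problem.  It extends this seat's C-LIP row (`StateLipschitzRows`, one-link
door `β_W < 2/9`) to the star door `β_W ≤ 9/25` by a different mechanism (memo NEXT-STAR-WINDOW-CLIP Route B):
the exact torus derivative (`TorusStateResponse`) + the hypothesis-free torus star clustering, uniformly in the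
volume, + the unique thermodynamic limit.

* `torusEdge_injOn_of_supNorm_lt` — `torusEdge L` is injective on edge sets of `ℤ^d` of diameter `< L/2`.
* `su2_abs_cov_plaquette_torusState_le` — ONE TERM: on a torus `(ℤ/L)^4` carrying `StarWindowBound L β_W ρ`
  (`ρ < 1`), for a Lipschitz cylinder `F` (support `Λ` based within `D` of `x₀`, `4D + 4 < L`) and the centred lift
  `s`, `|Cov_{torusState}(F, W_{(s y; i,j)})| ≤ A · r^{‖x₀ − s y‖₁}`, `A = 4(2√2)² e^{κ(D+3)} (#Λ K) 128`,
  `r = e^{−κ/4}`, `κ = starRate ρ`.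
* `su2_abs_responseSum_torusState_le` — THE SUM over the fundamental domain (= the torus derivative) is bounded by
  `2 · D₄ · A · ((1+r)/(1−r))^4` UNIFORMLY IN `L` (rb-p1's lattice `ℓ¹` sums).
* `su2_abs_integral_torusState_sub_le` — hence the torus state is Lipschitz in the coupling uniformly in `L`
  (mean value theorem), for all `0 ≤ β_W, β'_W ≤ β₁ ≤ 9/25` with `ρ = R_G(β₁)` (Lemma G + monotonicity).
* `su2_abs_integral_sub_integral_le_star` — C-LIP AT THE STAR WINDOW on `ℤ^4`: for `0 ≤ β_W, β'_W ≤ β₁ ≤ 9/25` and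
  the (unique) DLR states `μ`, `ν`: `|∫F dμ − ∫F dν| ≤ D₄ A ((1+r)/(1−r))^4 · |β_W − β'_W|` (unique thermodynamic
  limit, `tendsto_integral_torusState_of_subsingleton`); `su2_abs_integral_sub_integral_le_9_25` the instance
  `β₁ = 9/25`.

References (mechanism only): R. L. Dobrushin, S. B. Shlosman (1985) (the window condition `C_V`); B. Simon,
*The Statistical Mechanics of Lattice Gases* I (1993), §II.1; S. Friedli, Y. Velenik (2017), Lemma 6.30.
-/

noncomputable section

open MeasureTheory ProbabilityTheory Function Finset Filter Topology Real
open scoped NNReal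
open Literature.Probability.LatticeModels (Torus.proj Torus.proj_apply)
open Literature.MathematicalPhysics.QuantumLattice (LGConfig ZdEdge ZdPlaquette plaquetteEdges torusLift torusEdge
  toTorusObservable toTorusObservable_apply fundamentalRep continuous_fundamentalRep ymSpecification ymGibbsMeasures)
open Literature.MathematicalPhysics.QuantumFieldTheory hiding ZdEdge
open Summit.Ventures.YMGap.DSWindow (StarWindowBound starRate starRate_pos gaugeR_mono)
open Summit.Ventures.YMGap.StarWindowGauge (gaugeR gaugeR_lt_one_of_le)
open Summit.Ventures.YMGap.StarLemmaG (starWindowBound_lemmaG gaugeR_nonneg)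
open Summit.Ventures.YMGap.StarRows (StarWindowBound.mono)
open Summit.Ventures.YMGap.StarLimit (su2Star_torus_cov_lipschitz continuous_of_isLipschitzCylinder)
open Summit.Ventures.YMGap.RobustBall (l1 l1_sub_comm numOrient sum_pow_l1_sub_le)
open Summit.Ventures.YMGap.PlaquetteSusceptibility (l1_le_mul_norm)

namespace Summit.Ventures.YMGap.CouplingResponse

/-! ### §1 Geometry: injectivity of the projection on small edge sets -/

section Geometry

variable {d : ℕ}

/-- `torusEdge L` is injective on an edge set all of whose base points are `< L/2` apart in the sup-norm.
[folklore] -/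
theorem torusEdge_injOn_of_supNorm_lt {L : ℕ} {S : Finset (ZdEdge d)}
    (h : ∀ e ∈ S, ∀ e' ∈ S, 2 * Literature.Probability.LatticeModels.Site.supNorm (e.1 - e'.1) < L) :
    ∀ e ∈ S, ∀ e' ∈ S, torusEdge L e = torusEdge L e' → e = e' := by
  intro e he e' he' hee'
  simp only [torusEdge, Prod.mk.injEq] at hee'
  refine Prod.ext (eq_of_torusProj_eq_of_natAbs_lt hee'.1 fun k => ?_) hee'.2
  have h1 := Literature.Probability.LatticeModels.Site.natAbs_le_supNorm (e.1 - e'.1) k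
  have h2 := h e he e' he'
  simp only [Pi.sub_apply] at h1
  omega

/-- Base points of a support within `D` of `x₀` are pairwise `≤ 2D` apart, so `torusEdge L` is injective on it
once `4D < L`. [folklore] -/
theorem torusEdge_injOn_of_norm_le {L D : ℕ} {S : Finset (ZdEdge d)} {x₀ : Literature.Probability.LatticeModels.Site d}
    (hD : ∀ e ∈ S, ‖e.1 - x₀‖ ≤ D) (hL : 4 * D < L) :
    ∀ e ∈ S, ∀ e' ∈ S, torusEdge L e = torusEdge L e' → e = e' := by
  refine torusEdge_injOn_of_supNorm_lt fun e he e' he' => ?_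
  have h1 : (Literature.Probability.LatticeModels.Site.supNorm (e.1 - e'.1) : ℝ) ≤ 2 * D := by
    rw [← Literature.Probability.LatticeModels.Site.norm_eq_supNorm]
    calc ‖e.1 - e'.1‖ = ‖(e.1 - x₀) - (e'.1 - x₀)‖ := by congr 1; abel
      _ ≤ ‖e.1 - x₀‖ + ‖e'.1 - x₀‖ := norm_sub_le _ _
      _ ≤ D + D := add_le_add (hD e he) (hD e' he')
      _ = 2 * D := by ring
  have h2 : Literature.Probability.LatticeModels.Site.supNorm (e.1 - e'.1) ≤ 2 * D := by exact_mod_cast h1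
  omega

/-- `‖proj z‖_{∞,L} ≤ ‖z‖_∞` in the real form `≤ ‖z‖`. [folklore] -/
theorem torusNorm_proj_le_norm (L : ℕ) (z : Literature.Probability.LatticeModels.Site d) :
    (torusNorm (Torus.proj L z : Site d L) : ℝ) ≤ ‖z‖ := by
  rw [Literature.Probability.LatticeModels.Site.norm_eq_supNorm]
  exact_mod_cast torusNorm_proj_le (L := L) z

end Geometry

/-! ### §2 One term: the torus covariance of `F` with a far plaquette -/

section OneTerm

variable {L : ℕ} [NeZero L]

/-- **One term of the response sum.**  `SU(2)`, `d = 4`, torus `(ℤ/L)^4` carrying `StarWindowBound L β_W ρ` with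
`0 ≤ ρ < 1`; `F` a Lipschitz cylinder function of `ℤ^4` (support `Λ`, constant `K`, every link of `Λ` based within
sup-distance `D` of `x₀`), `4D + 4 < L`; `s` a centred lift at `x₀` (`proj ∘ s = id`,
`‖y − proj x₀‖_{∞,L} = ‖s y − x₀‖_∞`).  Then for every torus site `y` and plane `i < j`, at tree coupling `β_W/2`:
`|Cov_{torusState}(F, W_{(s y; i, j)})| ≤ 4(2√2)² e^{κ(D+3)} (#Λ K) 128 · (e^{−κ/4})^{‖x₀ − s y‖₁}`,
`κ = starRate ρ`, `W = (1/2) Re tr U_q` — the torus star door `su2Star_torus_cov_lipschitz` with separation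
`‖s y − x₀‖_∞ − D − 1`. [folklore] -/
theorem su2_abs_cov_plaquette_torusState_le (βW : ℝ) {ρ : ℝ} (hρ0 : 0 ≤ ρ) (hρ1 : ρ < 1)
    (hS : StarWindowBound L βW ρ suFrobDist)
    {F : LGConfig 4 (Matrix.specialUnitaryGroup (Fin 2) ℂ) → ℝ} {Λ : Finset (ZdEdge 4)} {K : ℝ≥0}
    (hF : IsLipschitzCylinder (fundamentalRep (Fin 2)) F Λ K)
    {x₀ : Literature.Probability.LatticeModels.Site 4} {D : ℕ} (hD : ∀ e ∈ Λ, ‖e.1 - x₀‖ ≤ D) (hL : 4 * D + 4 < L)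
    {s : Site 4 L → Literature.Probability.LatticeModels.Site 4} (hs : ∀ y, (Torus.proj L (s y) : Site 4 L) = y)
    (hcen : ∀ y, torusNorm (y - Torus.proj L x₀) = Literature.Probability.LatticeModels.Site.supNorm (s y - x₀))
    (y : Site 4 L) (p : {p : Fin 4 × Fin 4 // p.1 < p.2}) :
    |cov[F, zdPlaquetteObs (fundamentalRep (Fin 2)) (s y) p.1.1 p.1.2;
        torusState (d := 4) (fundamentalRep (Fin 2)) (βW / 2) L]| ≤
      4 * (2 * Real.sqrt 2) ^ 2 * Real.exp (starRate ρ * (D + 3)) * ((Λ.card : ℝ) * K) * 128 *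
        Real.exp (-(starRate ρ / 4)) ^ l1 (x₀ - s y) := by
  classical
  haveI : SecondCountableTopology (Matrix (Fin 2) (Fin 2) ℂ) :=
    inferInstanceAs (SecondCountableTopology (Fin 2 → Fin 2 → ℂ))
  haveI : SecondCountableTopology (Matrix.specialUnitaryGroup (Fin 2) ℂ) :=
    Topology.IsEmbedding.subtypeVal.secondCountableTopology
  set q : ZdPlaquette 4 := (s y, p) with hq
  have hP := isLipschitzCylinder_zdPlaquetteObs (N := 2) (d := 4) (s y) p.2
  have hPm := hP.measurable
  -- the covariance under the torus state is the torus covariance of the lifts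
  have hcov : cov[F, zdPlaquetteObs (fundamentalRep (Fin 2)) (s y) p.1.1 p.1.2;
      torusState (d := 4) (fundamentalRep (Fin 2)) (βW / 2) L] =
      cov[toTorusObservable L F, toTorusObservable L (zdPlaquetteObs (fundamentalRep (Fin 2)) (s y) p.1.1 p.1.2);
        wilsonMeasure (d := 4) (L := L) (fundamentalRep (Fin 2)) (βW / 2)] := by
    rw [torusState, covariance_map hF.measurable.aestronglyMeasurable hPm.aestronglyMeasurable
      (measurable_torusLift L).aemeasurable]
    rfl
  rw [hcov]
  -- injectivity of the projection on the two supports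
  have hinj₁ := torusEdge_injOn_of_norm_le (L := L) hD (by omega)
  have hDq : ∀ e ∈ plaquetteEdges q, ‖e.1 - q.1‖ ≤ ((1 : ℕ) : ℝ) := fun e he => by
    simpa using norm_fst_sub_le_of_mem_plaquetteEdges he
  have hinj₂ := torusEdge_injOn_of_norm_le (L := L) hDq (by omega)
  -- separation of the projected base points
  set n : ℕ := torusNorm (y - Torus.proj L x₀) with hn
  have hgeom : ∀ a ∈ Λ, ∀ b ∈ plaquetteEdges q,
      n - (D + 1) ≤ torusNorm ((torusEdge L a).1 - (torusEdge L b).1) := by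
    intro a ha b hb
    have h1 : (torusNorm ((torusEdge L a).1 - (Torus.proj L x₀ : Site 4 L)) : ℝ) ≤ D := by
      simp only [torusEdge]
      rw [← torusProj_site_sub]
      exact (torusNorm_proj_le_norm L _).trans (hD a ha)
    have h2 : (torusNorm (y - (torusEdge L b).1) : ℝ) ≤ 1 := by
      simp only [torusEdge]
      rw [← hs y, ← torusProj_site_sub]
      refine (torusNorm_proj_le_norm L _).trans ?_
      have := hDq b hb
      rw [hq] at this
      simpa [norm_sub_rev] using this
    have h1' : torusNorm ((torusEdge L a).1 - (Torus.proj L x₀ : Site 4 L)) ≤ D := by exact_mod_cast h1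
    have h2' : torusNorm (y - (torusEdge L b).1) ≤ 1 := by exact_mod_cast h2
    have htri : n ≤ torusNorm (y - (torusEdge L b).1) +
        (torusNorm ((torusEdge L b).1 - (torusEdge L a).1) + torusNorm ((torusEdge L a).1 - Torus.proj L x₀)) :=
      (torusNorm_sub_le _ _ _).trans (Nat.add_le_add_left (torusNorm_sub_le _ _ _) _)
    have hsymm : torusNorm ((torusEdge L b).1 - (torusEdge L a).1) = torusNorm ((torusEdge L a).1 - (torusEdge L b).1) := by
      rw [← torusNorm_neg, neg_sub]
    omega
  have key := su2Star_torus_cov_lipschitz (L := L) βW hρ0 hρ1 hS hF hP hinj₁ hinj₂ hgeom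
  refine key.trans ?_
  -- constants: `#edges(q) · 4·2³ ≤ 128`, `e^{−κ(m − 2)} ≤ e^{κ(D+3)} r^{‖x₀ − s y‖₁}`
  have hκ := starRate_pos hρ0 hρ1
  have hcard : (((plaquetteEdges q).card : ℝ) * ((4 * (2 : ℝ≥0) ^ 3 : ℝ≥0) : ℝ)) ≤ 128 := by
    have hc : ((plaquetteEdges q).card : ℝ) ≤ 4 := by exact_mod_cast card_plaquetteEdges_le q
    push_cast
    nlinarith
  have hexp : Real.exp (-(starRate ρ * ((n - (D + 1) - 2 : ℕ) : ℝ))) ≤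
      Real.exp (starRate ρ * (D + 3)) * Real.exp (-(starRate ρ / 4)) ^ l1 (x₀ - s y) := by
    rw [← Real.exp_nat_mul, ← Real.exp_add]
    refine Real.exp_le_exp.2 ?_
    have hsub : (n : ℝ) - (D + 3) ≤ ((n - (D + 1) - 2 : ℕ) : ℝ) := by
      have : (n : ℤ) - (D + 3) ≤ ((n - (D + 1) - 2 : ℕ) : ℤ) := by omega
      exact_mod_cast this
    have hl1 : (l1 (x₀ - s y) : ℝ) ≤ 4 * n := by
      rw [l1_sub_comm, hn, hcen y, ← Literature.Probability.LatticeModels.Site.norm_eq_supNorm]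
      have := l1_le_mul_norm (d := 4) (s y - x₀)
      push_cast at this
      linarith
    nlinarith
  have hA : 0 ≤ 4 * (2 * Real.sqrt 2) ^ 2 := by positivity
  have hΛK : 0 ≤ (Λ.card : ℝ) * K := by positivity
  calc 4 * (2 * Real.sqrt 2) ^ 2 * Real.exp (-(starRate ρ * ((n - (D + 1) - 2 : ℕ) : ℝ))) *
        ((Λ.card : ℝ) * K) * (((plaquetteEdges q).card : ℝ) * ((4 * (2 : ℝ≥0) ^ 3 : ℝ≥0) : ℝ))
      ≤ 4 * (2 * Real.sqrt 2) ^ 2 * (Real.exp (starRate ρ * (D + 3)) * Real.exp (-(starRate ρ / 4)) ^ l1 (x₀ - s y)) *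
        ((Λ.card : ℝ) * K) * 128 := by
        gcongr
  _ = _ := by ring

end OneTerm

/-! ### §3 The response sum is bounded uniformly in the volume -/

section Sum

variable {L : ℕ} [NeZero L]

/-- **Uniform bound on the torus derivative.**  Under the hypotheses of `su2_abs_cov_plaquette_torusState_le`:
`|Σ_{y} Σ_{i<j} 2·Cov_{torusState}(F, W_{(s y;i,j)})| ≤ 2 · D₄ · A · ((1+r)/(1−r))^4`
(`A = 4(2√2)² e^{κ(D+3)} (#Λ K) 128`, `r = e^{−κ/4}`, `D₄ = 6` planes) — independent of `L`: the centred lift is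
injective, so the sum of `r^{‖x₀ − s y‖₁}` over the torus is a sum over distinct points of `ℤ^4`
(`RobustBall.LatticeSumL1.sum_pow_l1_sub_le`). [folklore] -/
theorem su2_abs_responseSum_torusState_le (βW : ℝ) {ρ : ℝ} (hρ0 : 0 ≤ ρ) (hρ1 : ρ < 1)
    (hS : StarWindowBound L βW ρ suFrobDist)
    {F : LGConfig 4 (Matrix.specialUnitaryGroup (Fin 2) ℂ) → ℝ} {Λ : Finset (ZdEdge 4)} {K : ℝ≥0}
    (hF : IsLipschitzCylinder (fundamentalRep (Fin 2)) F Λ K)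
    {x₀ : Literature.Probability.LatticeModels.Site 4} {D : ℕ} (hD : ∀ e ∈ Λ, ‖e.1 - x₀‖ ≤ D) (hL : 4 * D + 4 < L)
    {s : Site 4 L → Literature.Probability.LatticeModels.Site 4} (hs : ∀ y, (Torus.proj L (s y) : Site 4 L) = y)
    (hcen : ∀ y, torusNorm (y - Torus.proj L x₀) = Literature.Probability.LatticeModels.Site.supNorm (s y - x₀)) :
    |∑ y : Site 4 L, ∑ p : {p : Fin 4 × Fin 4 // p.1 < p.2},
        ((2 : ℕ) : ℝ) * cov[F, zdPlaquetteObs (fundamentalRep (Fin 2)) (s y) p.1.1 p.1.2;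
          torusState (d := 4) (fundamentalRep (Fin 2)) (βW / 2) L]| ≤
      2 * (numOrient 4 * (4 * (2 * Real.sqrt 2) ^ 2 * Real.exp (starRate ρ * (D + 3)) * ((Λ.card : ℝ) * K) * 128 *
        ((1 + Real.exp (-(starRate ρ / 4))) / (1 - Real.exp (-(starRate ρ / 4)))) ^ 4)) := by
  classical
  set r : ℝ := Real.exp (-(starRate ρ / 4)) with hr
  set A : ℝ := 4 * (2 * Real.sqrt 2) ^ 2 * Real.exp (starRate ρ * (D + 3)) * ((Λ.card : ℝ) * K) * 128 with hA
  have hκ := starRate_pos hρ0 hρ1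
  have hr0 : 0 ≤ r := (Real.exp_pos _).le
  have hr1 : r < 1 := Real.exp_lt_one_iff.2 (by linarith)
  have hA0 : 0 ≤ A := by positivity
  have hterm : ∀ (y : Site 4 L) (p : {p : Fin 4 × Fin 4 // p.1 < p.2}),
      |((2 : ℕ) : ℝ) * cov[F, zdPlaquetteObs (fundamentalRep (Fin 2)) (s y) p.1.1 p.1.2;
          torusState (d := 4) (fundamentalRep (Fin 2)) (βW / 2) L]| ≤ 2 * (A * r ^ l1 (x₀ - s y)) := by
    intro y p
    rw [abs_mul, Nat.cast_ofNat, abs_of_pos (by norm_num : (0 : ℝ) < 2)]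
    exact mul_le_mul_of_nonneg_left
      (su2_abs_cov_plaquette_torusState_le βW hρ0 hρ1 hS hF hD hL hs hcen y p) (by norm_num)
  have hsinj : Function.Injective s := fun y y' h => by rw [← hs y, ← hs y', h]
  calc |∑ y : Site 4 L, ∑ p : {p : Fin 4 × Fin 4 // p.1 < p.2},
          ((2 : ℕ) : ℝ) * cov[F, zdPlaquetteObs (fundamentalRep (Fin 2)) (s y) p.1.1 p.1.2;
            torusState (d := 4) (fundamentalRep (Fin 2)) (βW / 2) L]|
      ≤ ∑ y : Site 4 L, ∑ p : {p : Fin 4 × Fin 4 // p.1 < p.2},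
          |((2 : ℕ) : ℝ) * cov[F, zdPlaquetteObs (fundamentalRep (Fin 2)) (s y) p.1.1 p.1.2;
            torusState (d := 4) (fundamentalRep (Fin 2)) (βW / 2) L]| :=
        (Finset.abs_sum_le_sum_abs _ _).trans (Finset.sum_le_sum fun y _ => Finset.abs_sum_le_sum_abs _ _)
    _ ≤ ∑ y : Site 4 L, ∑ _p : {p : Fin 4 × Fin 4 // p.1 < p.2}, 2 * (A * r ^ l1 (x₀ - s y)) :=
        Finset.sum_le_sum fun y _ => Finset.sum_le_sum fun p _ => hterm y p
    _ = 2 * (numOrient 4 * (A * ∑ y : Site 4 L, r ^ l1 (x₀ - s y))) := by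
        simp only [Finset.sum_const, Finset.card_univ, nsmul_eq_mul, numOrient, Finset.mul_sum]
        ring
    _ = 2 * (numOrient 4 * (A * ∑ x ∈ (Finset.univ : Finset (Site 4 L)).image s, r ^ l1 (x₀ - x))) := by
        rw [Finset.sum_image fun y _ y' _ h => hsinj h]
    _ ≤ 2 * (numOrient 4 * (A * ((1 + r) / (1 - r)) ^ 4)) := by
        have := sum_pow_l1_sub_le hr0 hr1 x₀ ((Finset.univ : Finset (Site 4 L)).image s)
        gcongr

end Sum

/-! ### §4 The torus state is Lipschitz in the coupling, uniformly in the volume -/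

section TorusLipschitz

/-- **Star windows for all couplings up to `β₁ ≤ 9/25` with ONE received sum**: Lemma G on every torus `L ≥ 3`
and monotonicity of `R_G` (`gaugeR_mono`, `StarWindowBound.mono`). -/
theorem su2_starWindowBound_uniform {L : ℕ} [NeZero L] (hL : 3 ≤ L) {β₁ βW : ℝ} (h0 : 0 ≤ βW) (h : βW ≤ β₁)
    (h1 : β₁ ≤ 9 / 25) : StarWindowBound L βW (gaugeR β₁) suFrobDist :=
  StarWindowBound.mono (starWindowBound_lemmaG hL h0 (by linarith)) (gaugeR_mono h0 h (by linarith))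

/-- **The torus state is Lipschitz in the coupling, uniformly in `L`** (`SU(2)`, `d = 4`): for `β₁ ≤ 9/25`,
`ρ = R_G(β₁)`, every torus side `L > 4D + 4`, every Lipschitz cylinder `F` as above and all `0 ≤ β_W, β'_W ≤ β₁`:
`|∫F dτ_{L,β_W/2} − ∫F dτ_{L,β'_W/2}| ≤ D₄ A ((1+r)/(1−r))^4 · |β_W − β'_W|` — the mean value theorem on the exact
derivative (`hasDerivAt_integral_torusState_SU`) bounded by `su2_abs_responseSum_torusState_le`. [folklore] -/
theorem su2_abs_integral_torusState_sub_le {L : ℕ} [NeZero L] {β₁ : ℝ} (h1 : β₁ ≤ 9 / 25)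
    {F : LGConfig 4 (Matrix.specialUnitaryGroup (Fin 2) ℂ) → ℝ} {Λ : Finset (ZdEdge 4)} {K : ℝ≥0}
    (hF : IsLipschitzCylinder (fundamentalRep (Fin 2)) F Λ K)
    {x₀ : Literature.Probability.LatticeModels.Site 4} {D : ℕ} (hD : ∀ e ∈ Λ, ‖e.1 - x₀‖ ≤ D) (hL : 4 * D + 4 < L)
    {βW βW' : ℝ} (h0 : 0 ≤ βW) (hβ : βW ≤ β₁) (h0' : 0 ≤ βW') (hβ' : βW' ≤ β₁) :
    |(∫ U, F U ∂(torusState (d := 4) (fundamentalRep (Fin 2)) (βW / 2) L)) -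
        ∫ U, F U ∂(torusState (d := 4) (fundamentalRep (Fin 2)) (βW' / 2) L)| ≤
      numOrient 4 * (4 * (2 * Real.sqrt 2) ^ 2 * Real.exp (starRate (gaugeR β₁) * (D + 3)) * ((Λ.card : ℝ) * K) *
        128 * ((1 + Real.exp (-(starRate (gaugeR β₁) / 4))) / (1 - Real.exp (-(starRate (gaugeR β₁) / 4)))) ^ 4) *
        |βW - βW'| := by
  classical
  haveI : SecondCountableTopology (Matrix (Fin 2) (Fin 2) ℂ) :=
    inferInstanceAs (SecondCountableTopology (Fin 2 → Fin 2 → ℂ))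
  haveI : SecondCountableTopology (Matrix.specialUnitaryGroup (Fin 2) ℂ) :=
    Topology.IsEmbedding.subtypeVal.secondCountableTopology
  set ρ := gaugeR β₁ with hρ
  have hβ₁0 : 0 ≤ β₁ := h0.trans hβ
  have hρ0 : 0 ≤ ρ := gaugeR_nonneg hβ₁0 (by linarith)
  have hρ1 : ρ < 1 := gaugeR_lt_one_of_le hβ₁0 h1
  obtain ⟨s, hs, hcen, -⟩ := exists_centredLift L x₀ (d := 4)
  set B : ℝ := 2 * (numOrient 4 * (4 * (2 * Real.sqrt 2) ^ 2 * Real.exp (starRate ρ * (D + 3)) *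
    ((Λ.card : ℝ) * K) * 128 * ((1 + Real.exp (-(starRate ρ / 4))) / (1 - Real.exp (-(starRate ρ / 4)))) ^ 4)) with hB
  set φ : ℝ → ℝ := fun b => ∫ U, F U ∂(torusState (d := 4) (fundamentalRep (Fin 2)) b L) with hφ
  have hFb : ∀ U, |F U| ≤ |F 1| + 2 * K := fun U => hF.abs_le U
  -- derivative and its bound on the segment `[0, β₁/2]`
  have hderiv : ∀ b ∈ Set.Icc (0 : ℝ) (β₁ / 2), HasDerivWithinAt φ
      (∑ y : Site 4 L, ∑ p : {p : Fin 4 × Fin 4 // p.1 < p.2},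
        ((2 : ℕ) : ℝ) * cov[F, zdPlaquetteObs (fundamentalRep (Fin 2)) (s y) p.1.1 p.1.2;
          torusState (d := 4) (fundamentalRep (Fin 2)) b L]) (Set.Icc (0 : ℝ) (β₁ / 2)) b :=
    fun b _ => (hasDerivAt_integral_torusState_SU (d := 4) (N := 2) hF.measurable hFb hs b).hasDerivWithinAt
  have hbound : ∀ b ∈ Set.Icc (0 : ℝ) (β₁ / 2),
      ‖∑ y : Site 4 L, ∑ p : {p : Fin 4 × Fin 4 // p.1 < p.2},
        ((2 : ℕ) : ℝ) * cov[F, zdPlaquetteObs (fundamentalRep (Fin 2)) (s y) p.1.1 p.1.2;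
          torusState (d := 4) (fundamentalRep (Fin 2)) b L]‖ ≤ B := by
    intro b hb
    have hSb : StarWindowBound L (2 * b) ρ suFrobDist :=
      su2_starWindowBound_uniform (by omega) (by linarith [hb.1]) (by linarith [hb.2]) h1
    have := su2_abs_responseSum_torusState_le (2 * b) hρ0 hρ1 hSb hF hD hL hs hcen
    rw [show 2 * b / 2 = b by ring] at this
    rw [Real.norm_eq_abs]
    exact this
  have hmv := (convex_Icc (0 : ℝ) (β₁ / 2)).norm_image_sub_le_of_norm_hasDerivWithin_le hderiv hbound
    (show βW' / 2 ∈ Set.Icc (0 : ℝ) (β₁ / 2) from ⟨by linarith, by linarith⟩)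
    (show βW / 2 ∈ Set.Icc (0 : ℝ) (β₁ / 2) from ⟨by linarith, by linarith⟩)
  rw [Real.norm_eq_abs, Real.norm_eq_abs] at hmv
  refine hmv.trans (le_of_eq ?_)
  rw [show βW / 2 - βW' / 2 = (βW - βW') / 2 by ring, abs_div, abs_of_pos (by norm_num : (0 : ℝ) < 2), hB]
  ring

end TorusLipschitz

/-! ### §5 C-LIP at the star window on `ℤ^4` -/

section Zd

/-- **C-LIP AT THE STAR WINDOW** (`SU(2)`, `d = 4`, Wilson action, hypothesis-free): for `β₁ ≤ 9/25`, all Wilson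
couplings `0 ≤ β_W, β'_W ≤ β₁`, the DLR states `μ` at `β_W` and `ν` at `β'_W` (tree bare coupling
`2·(β_W/4) = β_W/2`; unique by `su2_hasUniqueGibbsMeasure_le_9_25`), and every Lipschitz cylinder function `F`
(support `Λ`, constant `K`, every link of `Λ` based within sup-distance `D` of `x₀`):
`|∫F dμ − ∫F dν| ≤ D₄ · 4(2√2)² e^{κ(D+3)} (#Λ K) 128 ((1+r)/(1−r))^4 · |β_W − β'_W|`,
`κ = starRate (R_G β₁)`, `r = e^{−κ/4}` — the torus bound `su2_abs_integral_torusState_sub_le` passed to the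
unique thermodynamic limit (`tendsto_integral_torusState_of_subsingleton`).  Extends the one-link-window row
`StateLipschitzRows.su2_abs_integral_sub_integral_le` (`β_W < 2/9`) to `β_W ≤ 9/25 = 0.36`. [folklore] -/
theorem su2_abs_integral_sub_integral_le_star {β₁ : ℝ} (h1 : β₁ ≤ 9 / 25)
    {βW βW' : ℝ} (h0 : 0 ≤ βW) (hβ : βW ≤ β₁) (h0' : 0 ≤ βW') (hβ' : βW' ≤ β₁)
    {μ ν : Measure (LGConfig 4 (Matrix.specialUnitaryGroup (Fin 2) ℂ))}
    (hμ : μ ∈ ymGibbsMeasures (d := 4) (fundamentalRep (Fin 2)) (2 * (βW / 4)))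
    (hν : ν ∈ ymGibbsMeasures (d := 4) (fundamentalRep (Fin 2)) (2 * (βW' / 4)))
    {F : LGConfig 4 (Matrix.specialUnitaryGroup (Fin 2) ℂ) → ℝ} {Λ : Finset (ZdEdge 4)} {K : ℝ≥0}
    (hF : IsLipschitzCylinder (fundamentalRep (Fin 2)) F Λ K)
    {x₀ : Literature.Probability.LatticeModels.Site 4} {D : ℕ} (hD : ∀ e ∈ Λ, ‖e.1 - x₀‖ ≤ D) :
    |(∫ U, F U ∂μ) - ∫ U, F U ∂ν| ≤
      numOrient 4 * (4 * (2 * Real.sqrt 2) ^ 2 * Real.exp (starRate (gaugeR β₁) * (D + 3)) * ((Λ.card : ℝ) * K) *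
        128 * ((1 + Real.exp (-(starRate (gaugeR β₁) / 4))) / (1 - Real.exp (-(starRate (gaugeR β₁) / 4)))) ^ 4) *
        |βW - βW'| := by
  haveI : SecondCountableTopology (Matrix (Fin 2) (Fin 2) ℂ) :=
    inferInstanceAs (SecondCountableTopology (Fin 2 → Fin 2 → ℂ))
  haveI : SecondCountableTopology (Matrix.specialUnitaryGroup (Fin 2) ℂ) :=
    Topology.IsEmbedding.subtypeVal.secondCountableTopology
  have hFc : Continuous F := continuous_of_isLipschitzCylinder hF
  have hFb : ∀ U, |F U| ≤ |F 1| + 2 * K := fun U => hF.abs_le U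
  have e1 : (2 : ℝ) * (βW / 4) = βW / 2 := by ring
  have e2 : (2 : ℝ) * (βW' / 4) = βW' / 2 := by ring
  have huμ := DSWindowZd.su2_hasUniqueGibbsMeasure_le_9_25 h0 (hβ.trans h1)
  have huν := DSWindowZd.su2_hasUniqueGibbsMeasure_le_9_25 h0' (hβ'.trans h1)
  have e1' : ((2 : ℕ) : ℝ) * (βW / 4) = βW / 2 := by push_cast; ring
  have e2' : ((2 : ℕ) : ℝ) * (βW' / 4) = βW' / 2 := by push_cast; ring
  rw [e1'] at huμ; rw [e2'] at huν
  rw [e1] at hμ; rw [e2] at hν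
  have tμ := tendsto_integral_torusState_of_subsingleton (d := 4) (fundamentalRep (Fin 2))
    (continuous_fundamentalRep (Fin 2)) huμ.1 hμ hFc hFb
  have tν := tendsto_integral_torusState_of_subsingleton (d := 4) (fundamentalRep (Fin 2))
    (continuous_fundamentalRep (Fin 2)) huν.1 hν hFc hFb
  refine le_of_tendsto (tμ.sub tν).abs ?_
  filter_upwards [Filter.eventually_ge_atTop (4 * D + 4)] with L hL
  exact su2_abs_integral_torusState_sub_le (L := L + 1) h1 hF hD (by omega) h0 hβ h0' hβ'

/-- **The instance `β₁ = 9/25`**: C-LIP for every `0 ≤ β_W, β'_W ≤ 9/25` (Wilson `β_W = 0.36`, 't Hooft `9/100`),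
hypothesis-free. [folklore] -/
theorem su2_abs_integral_sub_integral_le_9_25
    {βW βW' : ℝ} (h0 : 0 ≤ βW) (hβ : βW ≤ 9 / 25) (h0' : 0 ≤ βW') (hβ' : βW' ≤ 9 / 25)
    {μ ν : Measure (LGConfig 4 (Matrix.specialUnitaryGroup (Fin 2) ℂ))}
    (hμ : μ ∈ ymGibbsMeasures (d := 4) (fundamentalRep (Fin 2)) (2 * (βW / 4)))
    (hν : ν ∈ ymGibbsMeasures (d := 4) (fundamentalRep (Fin 2)) (2 * (βW' / 4)))
    {F : LGConfig 4 (Matrix.specialUnitaryGroup (Fin 2) ℂ) → ℝ} {Λ : Finset (ZdEdge 4)} {K : ℝ≥0}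
    (hF : IsLipschitzCylinder (fundamentalRep (Fin 2)) F Λ K)
    {x₀ : Literature.Probability.LatticeModels.Site 4} {D : ℕ} (hD : ∀ e ∈ Λ, ‖e.1 - x₀‖ ≤ D) :
    |(∫ U, F U ∂μ) - ∫ U, F U ∂ν| ≤
      numOrient 4 * (4 * (2 * Real.sqrt 2) ^ 2 * Real.exp (starRate (gaugeR (9 / 25)) * (D + 3)) *
        ((Λ.card : ℝ) * K) * 128 *
        ((1 + Real.exp (-(starRate (gaugeR (9 / 25)) / 4))) / (1 - Real.exp (-(starRate (gaugeR (9 / 25)) / 4)))) ^ 4) *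
        |βW - βW'| :=
  su2_abs_integral_sub_integral_le_star le_rfl h0 hβ h0' hβ' hμ hν hF hD

end Zd

end Summit.Ventures.YMGap.CouplingResponse

end
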